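import Literature.Probability.RandomPlanarGeometry.HexSAWPolygonCellsRoof
import HarnessLib

/-!
# Cell calculus for honeycomb polygon surgery, III: HOSTS and the PORTS of the class-X flip and of the roof

Topic `Literature/Probability/RandomPlanarGeometry` (lane «pcv-sawmu», a-p4 g21; sequel of `HexSAWPolygonCells.lean` (cells, `perim`,
`perim_insert`, `IsLexmax`, the class-X flip) and `HexSAWPolygonCellsRoof.lean` (`roof`, `perim_union_roof_of_isLexmax`)).

The recursive step-two injection «OMEGA» (`HOME/pub-sawmu-a-p4/g21/omega/THEOREM-OMEGA-g21.md`) re-attaches every removed up-right spike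
`UR d` of a polygon at the PORT of its support `d`.  This file sets up the two notions and proves the port lemma (P1) of the THEOREM's §2 for
the two Madras–Slade moves:

* `IsBrickSet S` — every hexagon has `x + y` even (the genuine bricks of `ℍ`; needed from here on, since hosts are located by parity);
* `IsHost P d` — `d ∈ P`, `R d ∉ P`, `UL d ∉ P`, and `UR d` is lexicographically above every hexagon of `P`; equivalently `P + UR d` is again a
  brick set whose top hexagon is the new spike `UR d` (`isLexmax_insert_ur_of_isHost`, `card_contacts_ur_of_isHost` : the spike has the single
  contact `d`, so `perim (insert (UR d) P) = perim P + 4`);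
* `IsHost.row_cases` — a host lies on the top row at or left of the top hexagon `t`, or on the row below at abscissa `≥ t.x + 3`;
* ★ `card_contacts_portX` / `portX_notMem` — (P1) for the flip: in `insert (UL t) S` the port `UR (UL t)` of `t` is a clean leaf spot, and
  for every other host `d` of `S` the default port `UR d` is still a clean leaf spot (`card_contacts_ur_insert_ul_of_isHost`);
* ★ `card_contacts_portR` — (P1) for the roof: in `S ∪ roof t k` the port `UR a_{k−1}` of `t` is a clean leaf spot.

Sources: N. Madras, G. Slade, *The Self-Avoiding Walk* (1993), §3.2, proof of Theorem 3.2.3 (the surgery at the lexicographically largest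
point and the re-reading of the image) [MadrasSlade1993]; I. Jensen, J. Phys.: Conf. Ser. 42 (2006) 163 [Jensen2006HoneycombPolygons].
Label (lane): LANE INFRASTRUCTURE for an open combinatorial item; nothing new in writing.
-/

open Finset

namespace Literature.Probability.RandomPlanarGeometry.SAW

namespace HexCell

/-- A set of genuine bricks of `ℍ`: every hexagon `(x, y)` has `x + y` even. [cite: Jensen2006HoneycombPolygons, §2 (the honeycomb lattice as a brick wall)] -/
def IsBrickSet (S : Finset Cell) : Prop := ∀ c ∈ S, Even (c.1 + c.2)

/-- **Host**: a hexagon `d` of `P` on which an up-right spike can be grown so that the spike becomes the new top hexagon: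
`R d ∉ P`, `UL d ∉ P`, and `UR d` lies lexicographically above every hexagon of `P`.
[cite: MadrasSlade1993, §3.2 (proof of Theorem 3.2.3: the lexicographically largest point of the image)] -/
def IsHost (P : Finset Cell) (d : Cell) : Prop :=
  d ∈ P ∧ R d ∉ P ∧ UL d ∉ P ∧ ∀ c ∈ P, c.2 < d.2 + 1 ∨ (c.2 = d.2 + 1 ∧ c.1 < d.1 + 1)

/-- The top hexagon is a host. [cite: MadrasSlade1993, §3.2 (proof of Theorem 3.2.3)] -/
theorem IsLexmax.isHost {P : Finset Cell} {t : Cell} (h : IsLexmax P t) : IsHost P t := by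
  refine ⟨h.1, h.r_notMem, h.ul_notMem, fun c hc => ?_⟩
  rcases h.2 c hc with h1 | ⟨h1, h2⟩
  · left; omega
  · left; omega

/-- Growing the spike on a host produces the new top hexagon. [cite: MadrasSlade1993, §3.2 (proof of Theorem 3.2.3)] -/
theorem isLexmax_insert_ur_of_isHost {P : Finset Cell} {d : Cell} (h : IsHost P d) : IsLexmax (insert (UR d) P) (UR d) := by
  refine ⟨mem_insert_self _ _, fun c hc => ?_⟩
  rcases mem_insert.1 hc with rfl | hc
  · right; exact ⟨rfl, le_rfl⟩
  · rcases h.2.2.2 c hc with h1 | ⟨h1, h2⟩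
    · left; simpa using h1
    · right; simp; omega

/-- `UR d ∉ P` for a host `d`. [cite: MadrasSlade1993, §3.2 (proof of Theorem 3.2.3)] -/
theorem IsHost.ur_notMem {P : Finset Cell} {d : Cell} (h : IsHost P d) : UR d ∉ P := by
  intro hm
  rcases h.2.2.2 _ hm with h1 | ⟨-, h2⟩
  · simp at h1
  · simp at h2

/-- **The spike on a host has the single contact `d`** (so `perim` rises by `4`, `perim_insert_of_contacts_eq_one`).
[cite: MadrasSlade1993, §3.2 (proof of Theorem 3.2.3)] -/
theorem card_contacts_ur_of_isHost {P : Finset Cell} {d : Cell} (h : IsHost P d) : #(nbrs (UR d) ∩ P) = 1 := by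
  obtain ⟨a, b⟩ := d
  obtain ⟨hd, hR, hUL, htop⟩ := h
  have hR' : ((a + 1 + 1, b + 1 - 1) : Cell) ∉ P := by
    have e : ((a + 1 + 1, b + 1 - 1) : Cell) = R (a, b) := by ext <;> simp; ring
    rw [e]; exact hR
  have hUL' : ((a + 1 - 2, b + 1) : Cell) ∉ P := by
    have e : ((a + 1 - 2, b + 1) : Cell) = UL (a, b) := by ext <;> simp; ring
    rw [e]; exact hUL
  have hup : ∀ x y : ℤ, b + 1 ≤ y → ¬ (y = b + 1 ∧ x < a + 1) → ((x, y) : Cell) ∉ P := by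
    intro x y hy hne hm
    rcases htop _ hm with h1 | h2
    · dsimp only at h1; omega
    · dsimp only at h2; exact hne h2
  have e : nbrs (UR (a, b)) ∩ P = {(a, b)} := by
    ext c
    simp only [mem_inter, mem_nbrs_iff, UR_fst, UR_snd, mem_singleton]
    constructor
    · rintro ⟨hc, hcP⟩
      rcases hc with rfl | rfl | rfl | rfl | rfl | rfl
      · ext <;> simp
      · exact absurd hcP hR'
      · exact absurd hcP (hup _ _ (by omega) (by omega))
      · exact absurd hcP (hup _ _ (by omega) (by omega))
      · exact absurd hcP (hup _ _ (by omega) (by omega))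
      · exact absurd hcP hUL'
    · rintro rfl
      exact ⟨Or.inl (by ext <;> simp), hd⟩
  rw [e, card_singleton]

/-- Growing the spike on a host is a `+4` move. [cite: MadrasSlade1993, §3.2 (proof of Theorem 3.2.3)] -/
theorem perim_insert_ur_of_isHost {P : Finset Cell} {d : Cell} (h : IsHost P d) : perim (insert (UR d) P) = perim P + 4 :=
  perim_insert_of_contacts_eq_one h.ur_notMem (card_contacts_ur_of_isHost h)

/-- **Where hosts live**: with `t` the top hexagon of a brick set, a host `d` is on the top row at or left of `t`, or on the row below with
`d.x ≥ t.x + 3`. [cite: MadrasSlade1993, §3.2 (proof of Theorem 3.2.3)] -/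
theorem IsHost.row_cases {P : Finset Cell} {t d : Cell} (hP : IsBrickSet P) (ht : IsLexmax P t) (hd : IsHost P d) :
    (d.2 = t.2 ∧ d.1 ≤ t.1 ∧ (d = t ∨ d.1 ≤ t.1 - 4)) ∨ (d.2 = t.2 - 1 ∧ t.1 + 3 ≤ d.1) := by
  obtain ⟨a, b⟩ := t
  obtain ⟨x, y⟩ := d
  have h1 := ht.2 _ hd.1
  have h2 := hd.2.2.2 _ ht.1
  have pt := hP _ ht.1
  have pd := hP _ hd.1
  simp only at h1 h2 pt pd ⊢
  obtain ⟨m, hm⟩ := pt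
  obtain ⟨m', hm'⟩ := pd
  -- rows: y ≤ b (h1) and b < y + 1 ∨ (b = y + 1 ∧ a < x + 1) (h2)
  rcases h2 with h2 | ⟨h2, h3⟩
  · -- same row: y = b
    have hy : y = b := by rcases h1 with h1 | ⟨h1, -⟩ <;> omega
    subst hy
    have hx : x ≤ a := by rcases h1 with h1 | ⟨-, h1⟩ <;> omega
    left
    refine ⟨rfl, hx, ?_⟩
    by_cases hxa : x = a
    · left; subst hxa; rfl
    · right
      -- parity: x ≡ a (mod 2); `x = a − 2` would make `R d = t ∈ P`
      have hne : x ≠ a - 2 := by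
        intro hx2
        apply hd.2.1
        have : R (x, y) = (a, y) := by ext <;> simp [hx2]
        rw [this]; exact ht.1
      omega
  · right
    refine ⟨by omega, ?_⟩
    -- `d` on the row below; `x + 1 > a` from h3; parity gives `x ≥ a + 1`; `x = a + 1` would make `UL d = t ∈ P`
    have hne : x ≠ a + 1 := by
      intro hx1
      apply hd.2.2.1
      have : UL (x, y) = (a, b) := by ext <;> simp <;> omega
      rw [this]; exact ht.1
    omega

/-- The port of `t` after the class-X flip, `UR (UL t) = (t.x, t.y + 2)`, is not in the image. [cite: MadrasSlade1993, §3.2 (proof of Theorem 3.2.3)] -/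
theorem portX_notMem {S : Finset Cell} {t : Cell} (h : IsLexmax S t) : UR (UL t) ∉ insert (UL t) S := by
  rw [mem_insert, not_or]
  refine ⟨fun e => ?_, h.notMem_of_row_lt (by simp)⟩
  have := congrArg Prod.snd e; simp only [UR_snd, UL_snd] at this; omega

/-- ★ **(P1) for the flip, host `t`**: after the class-X flip the port `UR (UL t)` has the single contact `UL t`.
[cite: MadrasSlade1993, §3.2 (proof of Theorem 3.2.3: re-attaching at the image's top)] -/
theorem card_contacts_portX {S : Finset Cell} {t : Cell} (h : IsLexmax S t) :
    #(nbrs (UR (UL t)) ∩ insert (UL t) S) = 1 := by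
  obtain ⟨a, b⟩ := t
  -- every neighbour of the port other than `UL t` lies on a row `≥ b + 1`, hence is neither `UL t`'s row-mate… : we check each
  have hup : ∀ x y : ℤ, b + 1 ≤ y → ((x, y) : Cell) ≠ UL (a, b) → ((x, y) : Cell) ∉ insert (UL (a, b)) S := by
    intro x y hy hne hm
    rcases mem_insert.1 hm with hm | hm
    · exact hne hm
    · exact h.notMem_of_row_lt (by dsimp only; omega) hm
  have e : nbrs (UR (UL (a, b))) ∩ insert (UL (a, b)) S = {UL (a, b)} := by
    ext c
    simp only [mem_inter, mem_nbrs_iff, UR_fst, UR_snd, UL_fst, UL_snd, mem_singleton]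
    constructor
    · rintro ⟨hc, hcS⟩
      rcases hc with rfl | rfl | rfl | rfl | rfl | rfl
      · ext <;> simp
      · exact absurd hcS (hup _ _ (by omega) (by intro e; have := congrArg Prod.fst e; simp only [UL_fst] at this; omega))
      · exact absurd hcS (hup _ _ (by omega) (by intro e; have := congrArg Prod.snd e; simp only [UL_snd] at this; omega))
      · exact absurd hcS (hup _ _ (by omega) (by intro e; have := congrArg Prod.snd e; simp only [UL_snd] at this; omega))
      · exact absurd hcS (hup _ _ (by omega) (by intro e; have := congrArg Prod.snd e; simp only [UL_snd] at this; omega))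
      · exact absurd hcS (hup _ _ (by omega) (by intro e; have := congrArg Prod.fst e; simp only [UL_fst] at this; omega))
    · rintro rfl
      exact ⟨Or.inl (by ext <;> simp), mem_insert_self _ _⟩
  rw [e, card_singleton]

/-- ★ **(P1) for the flip, other hosts**: for a host `d ≠ t` of the brick set `S` (with `L t ∈ S`), the default port `UR d` still has the
single contact `d` after the flip — `UL t` is not adjacent to it. [cite: MadrasSlade1993, §3.2 (proof of Theorem 3.2.3)] -/
theorem card_contacts_ur_insert_ul_of_isHost {S : Finset Cell} {t d : Cell} (hS : IsBrickSet S) (ht : IsLexmax S t) (hL : L t ∈ S)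
    (hd : IsHost S d) (hne : d ≠ t) : UR d ∉ insert (UL t) S ∧ #(nbrs (UR d) ∩ insert (UL t) S) = 1 := by
  obtain ⟨a, b⟩ := t
  obtain ⟨x, y⟩ := d
  -- location of `d`: top row with `x ≤ a − 4`, in fact `x ≤ a − 6` since `R d ∉ S` excludes `x = a − 4` (`R d = L t`); or row below, `x ≥ a+3`
  have hloc := hd.row_cases hS ht
  have hfar : (y = b ∧ x ≤ a - 6) ∨ (y = b - 1 ∧ a + 3 ≤ x) := by
    rcases hloc with ⟨hy, -, hx⟩ | h2
    · rcases hx with hx | hx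
      · exact absurd hx hne
      · left; refine ⟨hy, ?_⟩
        have pt := hS _ ht.1; have pd := hS _ hd.1; simp only at pt pd
        obtain ⟨m, hm⟩ := pt
        obtain ⟨m', hm'⟩ := pd
        have hne4 : x ≠ a - 4 := by
          intro h4; apply hd.2.1
          have : R (x, y) = L (a, b) := by ext <;> simp <;> omega
          rw [this]; exact hL
        omega
    · exact Or.inr h2
  have hnotadj : UL (a, b) ∉ nbrs (UR (x, y)) := by
    simp only [mem_nbrs_iff, UR_fst, UR_snd, UL, Prod.mk.injEq, not_or]
    omega
  have hne' : UR (x, y) ≠ UL (a, b) := by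
    intro e; have := congrArg Prod.fst e; have := congrArg Prod.snd e; simp at *; omega
  refine ⟨?_, ?_⟩
  · rw [mem_insert, not_or]; exact ⟨hne', hd.ur_notMem⟩
  · have : nbrs (UR (x, y)) ∩ insert (UL (a, b)) S = nbrs (UR (x, y)) ∩ S := by
      rw [insert_eq, inter_union_distrib_left, inter_singleton_of_notMem hnotadj, empty_union]
    rw [this, card_contacts_ur_of_isHost hd]

/-- ★ **(P1) for the roof, host `t`**: after the roof of length `k ≥ 1` over the run `e_0..e_{k−1}` (`e_k ∉ S`), the port
`UR a_{k−1}` of `t` has the single contact `a_{k−1}` and is not in the image. [cite: MadrasSlade1993, §3.2 (proof of Theorem 3.2.3)] -/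
theorem card_contacts_portR {S : Finset Cell} {t : Cell} (h : IsLexmax S t) {k : ℕ} (hk : 1 ≤ k) (hend : runCell t k ∉ S) :
    UR (roofCell t (k - 1)) ∉ S ∪ roof t k ∧ #(nbrs (UR (roofCell t (k - 1))) ∩ (S ∪ roof t k)) = 1 := by
  classical
  obtain ⟨a, b⟩ := t
  obtain ⟨j, rfl⟩ : ∃ j, k = j + 1 := ⟨k - 1, by omega⟩
  simp only [Nat.add_sub_cancel]
  have hrow : ∀ c ∈ S ∪ roof (a, b) (j + 1), c.2 ≤ b := by
    intro c hc
    rcases mem_union.1 hc with hc | hc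
    · rcases h.2 c hc with h1 | ⟨h1, -⟩
      · exact h1.le
      · exact h1.le
    · obtain ⟨i, -, rfl⟩ := mem_roof.1 hc; simp
  refine ⟨fun hm => by have := hrow _ hm; simp at this, ?_⟩
  have e : nbrs (UR (roofCell (a, b) j)) ∩ (S ∪ roof (a, b) (j + 1)) = {roofCell (a, b) j} := by
    ext c
    simp only [mem_inter, mem_nbrs_iff, UR_fst, UR_snd, roofCell_fst, roofCell_snd, mem_singleton]
    constructor
    · rintro ⟨hc, hcS⟩
      rcases hc with rfl | rfl | rfl | rfl | rfl | rfl
      · ext <;> simp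
      · -- `LR (UR a_j) = R a_j = (a + 2j + 4, b)`: right of `t` on the top row, and not a roof cell of index ≤ j
        exfalso
        rcases mem_union.1 hcS with hc | hc
        · exact h.notMem_of_right (by simp) (by simp; omega) hc
        · obtain ⟨i, hi, ei⟩ := mem_roof.1 hc
          have := congrArg Prod.fst ei; simp only [roofCell_fst] at this; omega
      all_goals exfalso; have := hrow _ hcS; simp at this
    · rintro rfl
      exact ⟨Or.inl (by ext <;> simp), mem_union_right _ (mem_roof.2 ⟨j, by omega, rfl⟩)⟩
  rw [e, card_singleton]

end HexCell

end Literature.Probability.RandomPlanarGeometry.SAW
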